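import Summits.CriticalPhenomena.PercolationContinuityZ3.Theorems.Transplant.AutChartTreeTransversal
import Summits.CriticalPhenomena.PercolationContinuityZ3.Theorems.Transplant.SkelPhiQStepsN
import HarnessLib

/-!
# The TREE CHART of an action with finitely many orbits, II: the datum, EXACT fine `Δ`-steps through the fundamental domain, and the COARSE chart
# with `Skelφ.Lip` and EXACT-FOOTPRINT quasi-steps `Skelφ.QStepsN` — the quasi-step rung's step field is FREE for every orbit datum

builds on p205010 (kernel theorem, internal audit signed; external expert review pending) — nothing in this file uses p205010 and nothing here is a
percolation statement or a claim about any node.  Lane `prim-bschramm`, seat `prim-bschramm-p5` gen 28 (refuter / sharpness seat; R2′ finding F3,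
P5-SHARPNESS §60.3, lane INBOX 2026-08-27 05:49Z).  Helper file (`--supports stmt-CriticalPhenomena-4575 --as helper`): ONE structure (`TreeDatum`) and its
consequences; the existence of the datum from «AutChartTreeTransversal».

WHY (P5-SHARPNESS §60).  The Kozma–Nitzan kit layer of the lane survives quasi-steps only with the EXACT start footprint of `Skelφ.QStepsN`
(«SkelPhiQStepsN» :41: a walk of length `≤ M` all of whose vertices are at the start value of the chart or equal to the far end); the two-sided `InHull`
footprint of `Skelφ.PsiSteps` fails at the contact layer (§60.1).  This file shows that `QStepsN` costs NO customer.  A **tree datum** is an action by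
automorphisms with a CONNECTED transversal (any two representatives joined by a walk through representatives), a character `c : A → ℤ²` killing every
stabiliser, and, for every axis direction `± eᵢ`, an EDGE at a representative whose far end has zero-offset chart value EXACTLY `± Δ eᵢ` (`Δ ≥ 1`).  Then:
* §1 `exists_treeDatum`: every action by automorphisms of a connected graph with finitely many orbits and a rank-two character killing the stabilisers
  carries a tree datum (connected transversal + independent edge values of «AutChartTreeTransversal», re-based by `MaxArea.rebase` so that the two edge
  values become `Δ e₀`, `Δ e₁`, `Δ = |det|`; opposite signs from the reversed edges);
* §2 the FINE chart `chart = ochart` (zero offset, `A`-translating, `0` on the transversal) has **EXACT `Δ`-STEPS** `fine_step`: from every vertex a walk of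
  length `≤ |reps|` — the translate of a tree walk (chart CONSTANT along it) followed by ONE axis edge — ending at chart `+ Δ σ eᵢ`, every other vertex AT
  the start value; and `fine_lip`: edge increments bounded by `R` (local finiteness);
* §3 the COARSE chart `coarse = ⌊chart / N⌋`, `N = Δ (R + 1)`: **`coarse_lip : Skelφ.Lip G coarse`** and **`coarse_qStepsN : Skelφ.QStepsN G coarse ((R+1)·|reps|)`**
  — iterate the fine step until the coarse coordinate ticks (`exists_first_tick`: it ticks by exactly `σ` at some iterate `≤ R + 1`, the transversal
  coordinate never moves, every earlier vertex stays in the start cell): `LinkN`'s exact footprint on the nose.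
So the customer side of a `QStepsN` carrier needs no max-area re-basing and no single-edge step hypothesis: subdivided lattices, the rotor lattice, every
generating set of every virtually-(b₁ ≥ 2) group, every 2D/3D net qualify.  Coarse FRAMES and the packaged existence statement are the sequel.
[cite: KozmaNitzan2024, §4 p. 16 (Lemma 8: good coordinates)] [cite: MartineauTassion2017, §3.2] [cite: BenjaminiSchramm1996, §2 (almost transitive graphs)]
-/

noncomputable section

namespace Summit.CriticalPhenomena.PercolationContinuityZ3.Theorems.Transplant

open SimpleGraph Literature.Barriers.CriticalPhenomena Literature.Probability.LatticeModels Literature.Probability.Percolation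
open scoped Classical

namespace AutChart

variable {V : Type} {G : SimpleGraph V} {A : Type} [Group A] [MulAction A V]

/-- **Tree datum**: an action by automorphisms with a CONNECTED transversal `reps` (covering, pairwise inequivalent, any two members joined by a walk
through members), a character `c : A → ℤ²` killing every vertex stabiliser, a scale `Δ ≥ 1`, and for every axis direction `σ eᵢ` an EDGE at a representative
whose far end has zero-offset chart value exactly `Δ σ eᵢ`. [cite: KozmaNitzan2024, §4 p. 16 (Lemma 8)] [cite: BenjaminiSchramm1996, §2 (almost transitive graphs)] -/
structure TreeDatum (G : SimpleGraph V) (A : Type) [Group A] [MulAction A V] where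
  /-- the action is by graph automorphisms -/
  act : IsActionByAut G A
  /-- the representatives -/
  reps : Finset V
  /-- every vertex is a translate of a representative -/
  cover : ∀ w : V, ∃ a : A, ∃ r ∈ reps, a • r = w
  /-- the representatives are pairwise inequivalent -/
  trans : ∀ r ∈ reps, ∀ r' ∈ reps, ∀ a : A, a • r = r' → r = r'
  /-- the transversal is CONNECTED through representatives -/
  conn : ∀ r ∈ reps, ∀ r' ∈ reps, ∃ p : G.Walk r r', ∀ x ∈ p.support, x ∈ reps
  /-- the character -/
  c : A →* Multiplicative (Site 2)
  /-- the character kills every vertex stabiliser -/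
  stab : ∀ (v : V), ∀ h ∈ MulAction.stabilizer A v, c h = 1
  /-- the step scale -/
  Δ : ℕ
  /-- the step scale is positive -/
  one_le_Δ : 1 ≤ Δ
  /-- AXIS EDGES: for every direction an edge at a representative whose far end has chart value exactly `Δ σ eᵢ` -/
  axis : ∀ (i : Fin 2) (σ : ℤˣ), ∃ r ∈ reps, ∃ n : V, G.Adj r n ∧ ochart cover c n = Pi.single i ((Δ : ℤ) * σ)

/-! ## §1 Existence of a tree datum -/

/-- Reversing an edge at a representative NEGATES its chart value: if `r ∼ n` then `otyp n ∼ (osec n)⁻¹ • r` with value `− ochart n`. [folklore] -/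
theorem exists_adj_ochart_neg (hact : IsActionByAut G A) {reps : Finset V} (hcover : ∀ w : V, ∃ a : A, ∃ r ∈ reps, a • r = w)
    (htrans : ∀ r ∈ reps, ∀ r' ∈ reps, ∀ a : A, a • r = r' → r = r') (c : A →* Multiplicative (Site 2))
    (hstab : ∀ (v : V), ∀ h ∈ MulAction.stabilizer A v, c h = 1) {r n : V} (hr : r ∈ reps) (hrn : G.Adj r n) :
    ∃ r' ∈ reps, ∃ n' : V, G.Adj r' n' ∧ ochart hcover c n' = -ochart hcover c n := by
  obtain ⟨a, r', hr', han⟩ := hcover n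
  refine ⟨r', hr', a⁻¹ • r, ?_, ?_⟩
  · have h := (hact a⁻¹ r n).2 hrn
    rw [← han, inv_smul_smul] at h
    exact h.symm
  · rw [ochart_smul hcover htrans c hstab, ochart_of_mem hcover htrans c hstab hr, add_zero, ← han,
      ochart_smul_of_mem hcover htrans c hstab a hr', map_inv, toAdd_inv]

/-- **A TREE DATUM EXISTS** for every action by automorphisms of a connected, locally finite graph with finitely many orbits and a character of rank two
killing one stabiliser: connected transversal (`exists_connected_transversal`), two independent edge values `u`, `w` (`exists_indep_adj_values`), and the
character re-based on `(u, w)` (`rebaseHom`: `u ↦ Δ e₀`, `w ↦ Δ e₁`, `Δ = |det(u, w)|`). [cite: KozmaNitzan2024, §4 p. 16 (Lemma 8: good coordinates)] -/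
theorem exists_treeDatum [G.LocallyFinite] (hact : IsActionByAut G A) (hc : G.Connected) (reps₀ : Finset V)
    (hcover₀ : ∀ w : V, ∃ a : A, ∃ r ∈ reps₀, a • r = w) (c : A →* Multiplicative (Site 2)) {t : V}
    (hstab : ∀ h ∈ MulAction.stabilizer A t, c h = 1)
    (hrank : ∃ a b : A, MaxArea.det2 (Multiplicative.toAdd (c a)) (Multiplicative.toAdd (c b)) ≠ 0) :
    ∃ D : TreeDatum G A, ∃ u w : Site 2, D.c = (rebaseHom u w).comp c ∧ (D.Δ : ℤ) = |MaxArea.det2 u w| := by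
  have hstab' : ∀ (v : V), ∀ h ∈ MulAction.stabilizer A v, c h = 1 := map_stabilizer_eq_one_of_one hact hc c hstab
  obtain ⟨reps, hcover, htrans, hconn⟩ := exists_connected_transversal hact hc reps₀ hcover₀
  obtain ⟨r₁, hr₁, n₁, hn₁, r₂, hr₂, n₂, hn₂, hdet⟩ := exists_indep_adj_values hcover htrans c hstab' hact hc hrank
  set u := ochart hcover c n₁ with hu
  set w := ochart hcover c n₂ with hw
  set c' : A →* Multiplicative (Site 2) := (rebaseHom u w).comp c with hc'
  have hcstab : ∀ (v : V), ∀ h ∈ MulAction.stabilizer A v, c' h = 1 := fun v h hh => by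
    rw [hc', MonoidHom.comp_apply, hstab' v h hh, map_one]
  -- the re-based zero-offset chart is the re-basing of the old one
  have hoch : ∀ x : V, ochart hcover c' x = MaxArea.rebase u w (ochart hcover c x) := fun x => rfl
  have hΔ : (((MaxArea.det2 u w).natAbs : ℕ) : ℤ) = |MaxArea.det2 u w| := Int.natCast_natAbs _
  refine ⟨⟨hact, reps, hcover, htrans, hconn, c', hcstab, (MaxArea.det2 u w).natAbs, Int.natAbs_pos.2 hdet, ?_⟩, u, w, rfl, hΔ⟩
  -- the four axis edges: `n₁`, `n₂` and their reverses
  have h0 : ochart hcover c' n₁ = Pi.single 0 (((MaxArea.det2 u w).natAbs : ℕ) : ℤ) := by rw [hoch, hΔ, ← hu, MaxArea.rebase_left]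
  have h1 : ochart hcover c' n₂ = Pi.single 1 (((MaxArea.det2 u w).natAbs : ℕ) : ℤ) := by rw [hoch, hΔ, ← hw, MaxArea.rebase_right]
  intro i σ
  rcases Int.units_eq_one_or σ with rfl | rfl
  · fin_cases i
    · exact ⟨r₁, hr₁, n₁, hn₁, by rw [h0]; simp⟩
    · exact ⟨r₂, hr₂, n₂, hn₂, by rw [h1]; simp⟩
  · fin_cases i
    · obtain ⟨r', hr', n', hn', hv⟩ := exists_adj_ochart_neg hact hcover htrans c' hcstab hr₁ hn₁
      exact ⟨r', hr', n', hn', by rw [hv, h0, ← Pi.single_neg]; simp⟩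
    · obtain ⟨r', hr', n', hn', hv⟩ := exists_adj_ochart_neg hact hcover htrans c' hcstab hr₂ hn₂
      exact ⟨r', hr', n', hn', by rw [hv, h1, ← Pi.single_neg]; simp⟩

namespace TreeDatum

variable (D : TreeDatum G A)

/-! ## §2 The fine chart: translating, zero on the transversal, EXACT `Δ`-steps, bounded increments -/

/-- **The fine chart** `chart w = c (osec w)` (zero offset on the transversal). [folklore] -/
def chart (w : V) : Site 2 := ochart D.cover D.c w

/-- `chart = ochart`. [folklore] -/
theorem chart_eq (w : V) : D.chart w = ochart D.cover D.c w := rfl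

/-- **Equivariance**: `chart (a • w) = c a + chart w`. [folklore] -/
theorem chart_smul (a : A) (w : V) : D.chart (a • w) = Multiplicative.toAdd (D.c a) + D.chart w :=
  ochart_smul D.cover D.trans D.c D.stab a w

/-- `chart = 0` on the transversal. [folklore] -/
theorem chart_of_mem {r : V} (hr : r ∈ D.reps) : D.chart r = 0 := ochart_of_mem D.cover D.trans D.c D.stab hr

/-- **Tree walks are short**: two representatives are joined by a walk through representatives of length `≤ |reps| − 1` (a path). [folklore] -/
theorem exists_repPath {r r' : V} (hr : r ∈ D.reps) (hr' : r' ∈ D.reps) :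
    ∃ q : G.Walk r r', q.length + 1 ≤ D.reps.card ∧ ∀ x ∈ q.support, x ∈ D.reps := by
  obtain ⟨q, hq⟩ := D.conn r hr r' hr'
  refine ⟨q.bypass, ?_, fun x hx => hq x (q.support_bypass_subset_support hx)⟩
  have hnd : q.bypass.support.Nodup := q.bypass_isPath.support_nodup
  have hsub : q.bypass.support.toFinset ⊆ D.reps := fun x hx => hq x (q.support_bypass_subset_support (List.mem_toFinset.1 hx))
  have h := Finset.card_le_card hsub
  rwa [List.toFinset_card_of_nodup hnd, Walk.length_support] at h

/-- **EXACT FINE `Δ`-STEPS**: from every vertex, for every axis `i` and sign `σ`, a walk of length `≤ |reps|` ending at a vertex with chart EXACTLY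
`chart v + Δ σ eᵢ`, every vertex of which is at the start value or is the far end (translate by `osec v` the tree walk from `otyp v` to the representative
carrying the axis edge, then take that edge). [cite: KozmaNitzan2024, §4 p. 16 (Lemma 8)] -/
theorem fine_step (v : V) (i : Fin 2) (σ : ℤˣ) :
    ∃ (v' : V) (p : G.Walk v v'), p.length ≤ D.reps.card ∧ D.chart v' = D.chart v + Pi.single i ((D.Δ : ℤ) * σ) ∧
      ∀ x ∈ p.support, D.chart x = D.chart v ∨ x = v' := by
  obtain ⟨s, hs, n, hsn, hn⟩ := D.axis i σ
  obtain ⟨b, r, hr, rfl⟩ := D.cover v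
  obtain ⟨q, hql, hq⟩ := D.exists_repPath hr hs
  let q' : G.Walk r n := q.append (Walk.cons hsn Walk.nil)
  have hcv : D.chart (b • r) = Multiplicative.toAdd (D.c b) := by rw [D.chart_smul, D.chart_of_mem hr, add_zero]
  refine ⟨b • n, (q'.map (smulIso D.act b).toHom).copy rfl rfl, ?_, ?_, ?_⟩
  · rw [Walk.length_copy, Walk.length_map, Walk.length_append, Walk.length_cons, Walk.length_nil]
    omega
  · rw [D.chart_smul, hcv, D.chart_eq n, hn]
  · intro x hx
    rw [Walk.support_copy] at hx
    obtain ⟨x₀, hx₀, rfl⟩ := exists_mem_support_of_map_smul D.act b q' hx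
    rw [Walk.support_append, List.mem_append] at hx₀
    rcases hx₀ with hx₀ | hx₀
    · left
      rw [D.chart_smul, D.chart_of_mem (hq x₀ hx₀), add_zero, hcv]
    · right
      rw [Walk.support_cons, Walk.support_nil, List.tail_cons, List.mem_singleton] at hx₀
      rw [hx₀]

variable [G.LocallyFinite]

/-- **The increment bound** `R`: the largest coordinate (in absolute value) of a chart value within distance `1` of the transversal. [this work] -/
def R : ℕ := (dispSet (G := G) D.cover D.c 1).sup fun z => max (z 0).natAbs (z 1).natAbs

/-- Values of the displacement set `U_1` have coordinates `≤ R` in absolute value. [this work] -/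
theorem abs_le_R {z : Site 2} (hz : z ∈ dispSet (G := G) D.cover D.c 1) (j : Fin 2) : |z j| ≤ (D.R : ℤ) := by
  have h1 : max (z 0).natAbs (z 1).natAbs ≤ D.R := Finset.le_sup (f := fun z : Site 2 => max (z 0).natAbs (z 1).natAbs) hz
  have h2 : (z j).natAbs ≤ D.R := by
    fin_cases j
    · exact le_trans (le_max_left _ _) h1
    · exact le_trans (le_max_right _ _) h1
  rw [← Int.natCast_natAbs]
  exact_mod_cast h2

/-- **The fine chart has increments `≤ R` along edges** (translate the edge back to the type of its first endpoint). [folklore] -/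
theorem fine_lip {x y : V} (hxy : G.Adj x y) (j : Fin 2) : |D.chart y j - D.chart x j| ≤ (D.R : ℤ) := by
  obtain ⟨b, r, hr, rfl⟩ := D.cover x
  have hadj : G.Adj r (b⁻¹ • y) := by
    have h := (D.act b⁻¹ (b • r) y).2 hxy
    rwa [inv_smul_smul] at h
  have hmem : D.chart (b⁻¹ • y) ∈ dispSet (G := G) D.cover D.c 1 :=
    mem_dispSet D.cover D.c hr (mem_graphBall_one_of_adj G hadj)
  have hy : D.chart y = Multiplicative.toAdd (D.c b) + D.chart (b⁻¹ • y) := by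
    conv_lhs => rw [← smul_inv_smul b y]
    exact D.chart_smul b _
  have hx : D.chart (b • r) = Multiplicative.toAdd (D.c b) := by rw [D.chart_smul, D.chart_of_mem hr, add_zero]
  have e : D.chart y - D.chart (b • r) = D.chart (b⁻¹ • y) := by rw [hy, hx]; abel
  have h := D.abs_le_R hmem j
  rw [← e, Pi.sub_apply] at h
  exact h

/-! ## §3 The coarse chart: `1`-Lipschitz with EXACT-FOOTPRINT quasi-steps `Skelφ.QStepsN` -/

/-- **The coarse scale** `N = Δ (R + 1)` (a multiple of `Δ` at least `R`). [this work] -/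
def N : ℕ := D.Δ * (D.R + 1)

/-- `N > 0`. [folklore] -/
theorem N_pos : (0 : ℤ) < D.N := by
  have h1 := D.one_le_Δ
  have h : 1 ≤ D.N := le_trans h1 (Nat.le_mul_of_pos_right _ (Nat.succ_pos _))
  exact_mod_cast h

/-- `R ≤ N`. [folklore] -/
theorem R_le_N : (D.R : ℤ) ≤ D.N := by
  have h1 := D.one_le_Δ
  have h : D.R ≤ D.N := by
    calc D.R ≤ D.R + 1 := Nat.le_succ _
      _ = 1 * (D.R + 1) := (one_mul _).symm
      _ ≤ D.Δ * (D.R + 1) := Nat.mul_le_mul_right _ h1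
  exact_mod_cast h

/-- **The coarse chart** `coarse w = ⌊chart w / N⌋` (componentwise Euclidean quotient). [cite: KozmaNitzan2024, §4 p. 15 (boxes)] -/
def coarse (w : V) : Site 2 := fun j => D.chart w j / (D.N : ℤ)

/-- `coarse w j = chart w j / N`. [folklore] -/
theorem coarse_apply (w : V) (j : Fin 2) : D.coarse w j = D.chart w j / (D.N : ℤ) := rfl

/-- **The coarse chart is `1`-Lipschitz along edges** (`Skelφ.Lip`): fine increments are `≤ R ≤ N`. [folklore] -/
theorem coarse_lip : Skelφ.Lip G D.coarse := by
  intro x y hxy j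
  rw [D.coarse_apply, D.coarse_apply]
  refine ediv_sub_ediv_le D.N_pos ?_
  rw [abs_sub_comm]
  exact (D.fine_lip hxy j).trans D.R_le_N

/-- **Integer core of the coarse step**: for `Δ ≥ 1`, `N = Δ (R + 1)` and `σ = ±1` there is a first `k`, `1 ≤ k ≤ R + 1`, at which the Euclidean quotient
`(x + k Δ σ) / N` differs from `x / N`; there it equals `x / N + σ`, and it equals `x / N` at every earlier `j < k`. [folklore] -/
theorem exists_first_tick (x : ℤ) {Δ : ℕ} (hΔ : 1 ≤ Δ) (R : ℕ) (σ : ℤˣ) :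
    ∃ k : ℕ, 1 ≤ k ∧ k ≤ R + 1 ∧ (x + (k : ℤ) * Δ * σ) / ((Δ * (R + 1) : ℕ) : ℤ) = x / ((Δ * (R + 1) : ℕ) : ℤ) + σ ∧
      ∀ j : ℕ, j < k → (x + (j : ℤ) * Δ * σ) / ((Δ * (R + 1) : ℕ) : ℤ) = x / ((Δ * (R + 1) : ℕ) : ℤ) := by
  set N : ℤ := ((Δ * (R + 1) : ℕ) : ℤ) with hN_def
  have hNval : N = (Δ : ℤ) * (R + 1) := by rw [hN_def]; push_cast; ring
  have hΔpos : (0 : ℤ) < Δ := by exact_mod_cast (hΔ : 0 < Δ)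
  have hN : 0 < N := by rw [hNval]; exact mul_pos hΔpos (by positivity)
  have hσ : (σ : ℤ) = 1 ∨ (σ : ℤ) = -1 := by
    rcases Int.units_eq_one_or σ with h | h <;> [left; right] <;> rw [h] <;> rfl
  -- the predicate "the quotient has moved after `k` steps"
  have hPex : ∃ k : ℕ, (x + (k : ℤ) * Δ * σ) / N ≠ x / N := by
    refine ⟨R + 1, ?_⟩
    have e : x + ((R + 1 : ℕ) : ℤ) * Δ * σ = x + N * σ := by rw [hNval]; push_cast; ring
    rw [e, Int.add_mul_ediv_left _ _ hN.ne']
    generalize x / N = q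
    rcases hσ with h | h <;> rw [h] <;> omega
  have hk₀P : (x + ((Nat.find hPex : ℕ) : ℤ) * Δ * σ) / N ≠ x / N := Nat.find_spec hPex
  have hk₀le : Nat.find hPex ≤ R + 1 := Nat.find_min' hPex (by
    have e : x + ((R + 1 : ℕ) : ℤ) * Δ * σ = x + N * σ := by rw [hNval]; push_cast; ring
    rw [e, Int.add_mul_ediv_left _ _ hN.ne']
    generalize x / N = q
    rcases hσ with h | h <;> rw [h] <;> omega)
  have hlt : ∀ j : ℕ, j < Nat.find hPex → (x + (j : ℤ) * Δ * σ) / N = x / N := fun j hj =>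
    not_ne_iff.1 (Nat.find_min hPex hj)
  generalize hk₀def : Nat.find hPex = k₀ at hk₀P hk₀le hlt
  have hk₀pos : 1 ≤ k₀ := by
    by_contra h
    have h0 : k₀ = 0 := by omega
    apply hk₀P
    rw [h0]; simp
  obtain ⟨k₁, hk₁⟩ : ∃ k₁ : ℕ, k₀ = k₁ + 1 := ⟨k₀ - 1, by omega⟩
  have hprev : (x + (k₁ : ℤ) * Δ * σ) / N = x / N := hlt k₁ (by omega)
  -- consecutive fine values differ by `Δ ≤ N`, so their quotients differ by at most one
  have hΔN : (Δ : ℤ) ≤ N := by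
    rw [hNval]
    have : (0 : ℤ) ≤ R := by positivity
    nlinarith
  have hstep : x + (k₀ : ℤ) * Δ * σ = (x + (k₁ : ℤ) * Δ * σ) + Δ * σ := by rw [hk₁]; push_cast; ring
  have hdiff : |(x + (k₀ : ℤ) * Δ * σ) / N - (x + (k₁ : ℤ) * Δ * σ) / N| ≤ 1 := by
    refine ediv_sub_ediv_le hN ?_
    rw [hstep, add_sub_cancel_left]
    rcases hσ with h | h <;> rw [h] <;> simp [abs_of_nonneg (show (0:ℤ) ≤ Δ by positivity), hΔN]
  refine ⟨k₀, hk₀pos, hk₀le, ?_, hlt⟩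
  rw [abs_le, hprev] at hdiff
  rcases hσ with h | h
  · -- `σ = 1`: the quotient is monotone up
    have hmono : (x + (k₁ : ℤ) * Δ * σ) / N ≤ (x + (k₀ : ℤ) * Δ * σ) / N :=
      Int.ediv_le_ediv hN (by rw [hstep, h]; linarith)
    rw [hprev] at hmono
    generalize (x + (k₀ : ℤ) * Δ * σ) / N = q₀ at hdiff hk₀P hmono ⊢
    generalize x / N = q at hdiff hk₀P hmono ⊢
    rw [h]
    omega
  · have hmono : (x + (k₀ : ℤ) * Δ * σ) / N ≤ (x + (k₁ : ℤ) * Δ * σ) / N :=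
      Int.ediv_le_ediv hN (by rw [hstep, h]; linarith)
    rw [hprev] at hmono
    generalize (x + (k₀ : ℤ) * Δ * σ) / N = q₀ at hdiff hk₀P hmono ⊢
    generalize x / N = q at hdiff hk₀P hmono ⊢
    rw [h]
    omega

omit [G.LocallyFinite] in
/-- **Iterated fine steps**: `k` fine `Δ`-steps in direction `σ eᵢ` give a walk of length `≤ k |reps|` to a vertex at chart `+ k Δ σ eᵢ`, every vertex of
which is the far end or sits at an intermediate rung `+ j Δ σ eᵢ`, `j < k`. [folklore] -/
theorem fine_iter (v : V) (i : Fin 2) (σ : ℤˣ) (k : ℕ) :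
    ∃ (v' : V) (p : G.Walk v v'), p.length ≤ k * D.reps.card ∧ D.chart v' = D.chart v + Pi.single i ((k : ℤ) * D.Δ * σ) ∧
      ∀ x ∈ p.support, x = v' ∨ ∃ j : ℕ, j < k ∧ D.chart x = D.chart v + Pi.single i ((j : ℤ) * D.Δ * σ) := by
  induction k with
  | zero =>
    refine ⟨v, Walk.nil, by simp, by simp, fun x hx => Or.inl ?_⟩
    rw [Walk.support_nil, List.mem_singleton] at hx
    exact hx
  | succ k ih =>
    obtain ⟨v₁, p₁, hl₁, hc₁, hs₁⟩ := ih
    obtain ⟨v₂, p₂, hl₂, hc₂, hs₂⟩ := D.fine_step v₁ i σ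
    refine ⟨v₂, p₁.append p₂, ?_, ?_, ?_⟩
    · rw [Walk.length_append, Nat.succ_mul]
      omega
    · rw [hc₂, hc₁, add_assoc, ← Pi.single_add]
      congr 2
      push_cast
      ring
    · intro x hx
      rw [Walk.support_append, List.mem_append] at hx
      rcases hx with hx | hx
      · rcases hs₁ x hx with rfl | ⟨j, hj, hxj⟩
        · exact Or.inr ⟨k, Nat.lt_succ_self k, hc₁⟩
        · exact Or.inr ⟨j, by omega, hxj⟩
      · rcases hs₂ x (List.mem_of_mem_tail hx) with h | h
        · exact Or.inr ⟨k, Nat.lt_succ_self k, by rw [h, hc₁]⟩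
        · exact Or.inl h

/-- **THE COARSE CHART HAS EXACT-FOOTPRINT QUASI-STEPS** `Skelφ.QStepsN G coarse ((R + 1) · |reps|)`: iterate the fine `Δ`-step until the coarse
coordinate ticks (`exists_first_tick`); the end is at coarse `+ σ eᵢ` exactly (the transversal fine coordinate never moves), and every earlier vertex of
the walk sits at a fine rung `+ j Δ σ eᵢ`, `j < k`, whose coarse value is the start's — `LinkN`'s exact footprint. [cite: KozmaNitzan2024, §4 p. 16 (Lemma 8)]
[cite: MartineauTassion2017, §3.2] -/
theorem coarse_qStepsN : Skelφ.QStepsN G D.coarse ((D.R + 1) * D.reps.card) := by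
  intro v i σ
  obtain ⟨k, -, hkle, htick, hflat⟩ := exists_first_tick (D.chart v i) D.one_le_Δ D.R σ
  obtain ⟨v', p, hl, hc, hs⟩ := D.fine_iter v i σ k
  have hN : ((D.Δ * (D.R + 1) : ℕ) : ℤ) = (D.N : ℤ) := rfl
  -- the fine coordinates of a vertex at rung `j`
  have rung : ∀ (x : V) (j : ℕ), D.chart x = D.chart v + Pi.single i ((j : ℤ) * D.Δ * σ) →
      D.chart x i = D.chart v i + (j : ℤ) * D.Δ * σ ∧ ∀ j' : Fin 2, j' ≠ i → D.chart x j' = D.chart v j' := fun x j h =>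
    ⟨by rw [h, Pi.add_apply, Pi.single_eq_same], fun j' hj' => by rw [h, Pi.add_apply, Pi.single_eq_of_ne hj', add_zero]⟩
  refine ⟨v', ?_, p, hl.trans (Nat.mul_le_mul_right _ hkle), fun x hx => ?_⟩
  · -- the end: coarse `+ σ eᵢ`
    obtain ⟨hi, hother⟩ := rung v' k hc
    funext j
    rw [Pi.add_apply, D.coarse_apply, D.coarse_apply]
    by_cases hj : j = i
    · subst hj
      rw [Pi.single_eq_same, hi, ← hN, htick]
    · rw [Pi.single_eq_of_ne hj, add_zero, hother j hj]
  · -- the footprint: earlier vertices stay in the start cell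
    rcases hs x hx with h | ⟨j, hj, hxj⟩
    · exact Or.inr h
    · left
      obtain ⟨hi, hother⟩ := rung x j hxj
      funext j'
      rw [D.coarse_apply, D.coarse_apply]
      by_cases hj' : j' = i
      · subst hj'
        rw [hi, ← hN, hflat j hj]
      · rw [hother j' hj']

end TreeDatum

end AutChart

end Summit.CriticalPhenomena.PercolationContinuityZ3.Theorems.Transplant

end
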